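import Summits.QuantumFields.BalabanUV.Beta.D1BFx.RoadEndBFxTotalShellS
import Summits.QuantumFields.BalabanUV.Beta.D1BFx.SbpScalarEnd

/-!
# `BalabanUV.Beta.D1BFx.RoadEndBFxTotalSbpS` — road «BF-x» for binder row D1, slot (K): THE TOTAL-REST «ENDₛ» ENDs OF `RoadEndBFxTotalShellS` RE-WIRED OVER
# THE SUMMATION-BY-PARTS SCALAR WALL — **NO LEG SECOND-DIFFERENCE ROW** (`h2s`∕`d2s` DELETED; `h0`∕`h1` unconditional, `d0`∕`d1` from the printed statements)

HONEST DEPENDENCY (page 1, mandatory): continuum YM on T⁴ ⇐ BetaPertH ∧ nine spine estimates (0/9 proved); BetaPertH ⇐ (D1) ∧ (D4) ∧ CAP+tail;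
G-an2-4 gates asym, D1 and NE2/3/4.  HONEST FRAMING (cell contract, verbatim): «discharging `BetaPertH` makes Bałaban's UV stability UNCONDITIONAL —
a real constructive-QFT result; it is NOT the continuum limit and NOT the Clay problem.»  THIS MODULE DISCHARGES NOTHING of the wall by itself:
[folklore] re-wiring BY NAME of `RoadEndBFxTotalShellS` (§1–§3, p291248) with leaf-07's shell wall replaced by the owner's summation-by-parts wall
`SbpScalarEnd.d1Drift_of_strongRoad_sbp` (PARTS 1–4: `SbpShellAlgebra`, `SbpShellTerm`, `SbpShellRemainder`, `SbpScalarEnd`); every other line byte-identical.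
No `def`, no `Prop` mirror, no cited fact, 0 sorry.  0 root-level binders discharged (hW ∕ hR-sockets ∕ hSX-socket ∕ D1Tel ∕ D1Rep — 0); (K) NOT closed;
NOT D1, NOT `BetaPertH`, NOT continuum, NOT Clay.

ABSOLUTE RULE (cell charter, verbatim): «No internally-minted statement may enter as a cited fact. Every hypothesis is either kernel-proved in this
package or a verbatim quotation of a PUBLISHED theorem with page reference. The manuscript(s) under audit are NOT citable for their own disputed steps —
they are the thing under adjudication; programme-internal (2001/route/tribunal) claims are never citable.»

WHAT CHANGES AGAINST `RoadEndBFxTotalShellS` (owner gen 13, FINDING F-g13-1): the two displayed SHELL rows of the frozen profile — `h2s` (window shells) and `d2s`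
(exterior shells), with their constants `D₂`, `A₂`, `δ₂` — are GONE from all three ENDs: `d1Drift_BFx_total_sbpS` (was `…total_shellS`; rows `d0`∕`d1` displayed,
`h0`∕`h1` UNCONDITIONAL by `FrozenLegProfile.abs_gfrz_sub_gFree_le`∕`abs_gfrz_diff_flat_le`), `d1Drift_BFx_total_sbp_of_prop12S` (was `…shell_of_prop12S`; `d0`∕`d1`
and `Spr (Ga n a)` from [B5, Prop. 1.2] ∧ [(1.126)–(1.127)] BY NAME — so this END displays NO LEG ROW AT ALL), `d1Drift_BFx_total_sbp_of_prop12_of_perWordS`.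
Displayed, verbatim otherwise: bridge B1; (K) `hK` + `hωs` + `hlam`; the five slot-table sockets + covariance + bond swap; `hdiv`; `hrowgh`; `hRestTot` (resp. per-word
`hRest`); (U); `h12`∕`h126`.  The chain above (`…TotalShellGroupsS` → `RoadEndBFxWiredS` → `RoadEndBFxD1TelS`∕`D1SumS`; per-word and mean lanes) re-wires the same way.
Unit `b2b-balaban-beta-d1-p2` (gen 13), road «BF-x» OWNER; `LEAVES-BFx.md` row «C3-SBP ∕ END-SBP»; CENSUS-K6a §v4.22.
-/

noncomputable section

open Finset Filter Topology
open Literature.Probability.LatticeModels (annulus)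
open scoped BigOperators
open Literature.MathematicalPhysics.QuantumFieldTheory.Balaban1983to89
open Literature.MathematicalPhysics.QuantumFieldTheory.Balaban1983to89.Beta
open OneStepResolventKernel (JetData)
open OneStepKernelFamily (TbalOf D1Drift)
open WindowIdentification (fullSum psum)
open B12Sec2to5 (l1)
open DyadicShell (Pt toReal supNorm)
open ExpKernelCalculus (Site MKer BiLoc shiftK)
open SquareTable (stK)
open GhostTable (gFree)
open SpinTable (bfKernel)
open BubbleTransfer (unitVec)
open DressedMomentNormalisation (resSite)
open Summit.QuantumFields.BalabanUV.Beta.TameKernelCalculus (Spr)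
open Summit.QuantumFields.BalabanUV.Beta.D1BFx.GluonLeg (Ga)
open Summit.QuantumFields.BalabanUV.Beta.D1BFx.ReducedKernel (TableR TOfRed)
open Summit.QuantumFields.BalabanUV.Beta.D1BFx.DressedTadpoleTable (tableRed)
open Summit.QuantumFields.BalabanUV.Beta.D1BFx.ReducedKernelSandwich (fineHess)
open Summit.QuantumFields.BalabanUV.Beta.D1BFx.FineStencilBFBalaban (SbfBal)
open Summit.QuantumFields.BalabanUV.Beta.D1BFx.SecondStencilBF (Wbf)
open Summit.QuantumFields.BalabanUV.Beta.D1BFx.GhostKernelComplete (PghQ fineHessGhQ)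
open Summit.QuantumFields.BalabanUV.Beta.D1BFx.FrozenCorner (negAt)
open Summit.QuantumFields.BalabanUV.Beta.D1BFx.FrozenLegProfile (gfrz gfrz_neg gfrz_negAt decay_gfrz abs_gfrz_sub_gFree_le abs_gfrz_diff_flat_le)
open Summit.QuantumFields.BalabanUV.Beta.D1BFx.SplitInstance (RestIdx restK)
open Summit.QuantumFields.BalabanUV.Beta.D1BFx.SplitRecut (restK' restK'_corner_eq)
open Summit.QuantumFields.BalabanUV.Beta.D1BFx.SplitInstanceS (restKS restKS_corner_eq)
open Summit.QuantumFields.BalabanUV.Beta.D1BFx.CornerRest (rest_corner_bound)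
open Summit.QuantumFields.BalabanUV.Beta.D1BFx.CornerSummable (summable_weight₂_bfKernel summable_weight₁_bfKernel)
open Summit.QuantumFields.BalabanUV.Beta.D1BFx.Assembly (sum_uniform_resSite)
open Summit.QuantumFields.BalabanUV.Beta.D1BFx.AssemblyEnd (hT_of_pointwise)
open Summit.QuantumFields.BalabanUV.Beta.D1BFx.RoadEndBFxRecut (cornerIdx rowConst gfrz₀ gfrz₀_eq rowConst_nonneg)
open Summit.QuantumFields.BalabanUV.Beta.D1BFx.AssemblyEndTotalS (defect_le_at_totalS)
open Summit.QuantumFields.BalabanUV.Beta.D1BFx.SbpScalarEnd (d1Drift_of_strongRoad_sbp)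
open Summit.QuantumFields.BalabanUV.Beta.D1BFx.RoadEndBFxTotalShellS (rest_corner_recutS)
open Summit.QuantumFields.BalabanUV.Beta.D1BFx.RestTotalOfWordsS (hRestTot_of_hRestS)
open Summit.QuantumFields.BalabanUV.Beta.D1BFx.FrozenLegTails (nOf MOf hn1 far_rows_d0_d1_of_prop12)
open Summit.QuantumFields.BalabanUV.Beta.D1BFx.GluonLegTails (hGa_of_prop12)
open Summit.QuantumFields.BalabanUV.Beta.D1BFx.RoadEndBFxRecutTails (tailConst tailConst_nonneg)
open VectorTailsLoc (fam kfam)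
namespace Summit.QuantumFields.BalabanUV.Beta.D1BFx.RoadEndBFxTotalSbpS

/-! ## §1 The total-rest END over the summation-by-parts wall (no second-difference row), two-profile table, rescaled tie -/

variable {Lc : ℕ} [NeZero Lc] {a N : ℝ} {μ ν : Fin 4} {υ : Type*} [Fintype υ]
  {cE cVH cΛ cR cK cQ cE₂ cJ4 cΛ₂ cR₂ cQ₂ x₀ ωgl ωgh : ℕ → ℝ} {WE WJ WΛ WR WQ : ℕ → TableR} {CE CJ CΛ CRt CQ δW : ℕ → ℝ}
  {Ru : υ → ℕ → ℝ} {CU : υ → ℝ} {CRtot : ℝ} {A : ℕ → ℝ} {δ U₁ : ℝ}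

/-- [folklore] **ROAD BF-x, END TO END, TOTAL-REST FORM OVER THE SUMMATION-BY-PARTS WALL (NO SECOND-DIFFERENCE ROW), variant «ENDₛ»** — exactly leaf-03-g5's
`RoadEndBFxTotalShell.d1Drift_BFx_total_shell` with TWO edits: the loop-weight tie is the RESCALED `hωs : ω_gh n·(s n·cK n)² = −2·ω_gl n·cE n²`
(displayed scalar family `s : ℕ → ℝ`; `s ≡ 1` = the END of record, `s n = n⁻²` = END-ii), and `hRestTot` bounds the off-corner total of the TWO-PROFILE re-cut
words `restKS n a (gfrz n a b) (fun v => s n * gfrz n a b v) …` (ghost tadpole ∕ ghost bubble words at the rescaled frozen profile); every other hypothesis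
byte-identical (B1, (K), `Spr (Ga n a)`, sockets, `hdiv`, `hrowgh`, d0∕d1, (U) — and NO second-difference row); composed through the summation-by-parts wall `SbpScalarEnd.d1Drift_of_strongRoad_sbp` and
`AssemblyEndTotalS.defect_le_at_totalS`. -/
theorem d1Drift_BFx_total_sbpS (Js : ℕ → JetData 3 Lc) (hμν : μ ≠ ν) (hN : N ≠ 0) (hL : 2 ≤ Lc) (hodd : Odd Lc) (ha : 0 < a) (c : ℕ → ℝ)
    (hA : ∀ j, 0 ≤ A j) (hδ : 0 < δ)
    -- the frozen profile's far rows d0∕d1, pointwise (NO second-difference row)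
    (d0 : ∀ n : ℕ, 2 ≤ n → ∀ [NeZero n], ∀ b ∈ (univ : Finset (Fin 4 → Fin n)).image resSite, ∀ v : Pt, v ≠ 0 →
      |gfrz n a b v| ≤ A 0 * Real.exp (-(δ / n) * supNorm v) / (supNorm v : ℝ) ^ 2)
    (d1 : ∀ n : ℕ, 2 ≤ n → ∀ [NeZero n], ∀ b ∈ (univ : Finset (Fin 4 → Fin n)).image resSite, ∀ v : Pt, v ≠ 0 → ∀ ρ : Fin 4,
      |gfrz n a b (v + unitVec ρ) - gfrz n a b v| ≤ A 1 * Real.exp (-(δ / n) * supNorm v) / (supNorm v : ℝ) ^ 3)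
    -- bridge B1
    (hB1 : ∀ m : ℕ, 1 ≤ m → |(∑ j ∈ range m, B12Beta.secondMoment (TbalOf Lc Js j) μ ν) - c (Lc ^ m)| ≤ U₁)
    -- the (α)-leaf and slot (K) with the loop-weight ratio and the PINNED normalisation
    (hGa : ∀ n : ℕ, 2 ≤ n → ∀ [NeZero n], Spr (Ga n a))
    (hK : ∀ n : ℕ, 2 ≤ n → Odd n → ∀ [NeZero n], c n =
      ωgl n * B12Beta.secondMoment (TOfRed n a (SbfBal n a (cE n) (cVH n) (cΛ n) (cR n) (cK n) (cQ n))
        (tableRed n (Wbf (cE₂ n) (cJ4 n) (cΛ₂ n) (cR₂ n) (cQ₂ n) (WE n) (WJ n) (WΛ n) (WR n) (WQ n)))) μ ν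
      + ωgh n * B12Beta.secondMoment (PghQ n a (x₀ n) (cK n) (cQ n)) μ ν + ∑ u, Ru u n)
    (s : ℕ → ℝ) (hωs : ∀ n : ℕ, 2 ≤ n → ωgh n * (s n * cK n) ^ 2 = -2 * (ωgl n * cE n ^ 2))
    (hlam : ∀ n : ℕ, 2 ≤ n → ωgl n * cE n ^ 2 = 2 * N ^ 2 * (n : ℝ) ^ 8)
    -- slot-table sockets
    (hδW : ∀ n, 0 < δW n)
    (hE : ∀ n κ u l u', BiLoc (WE n κ u l u') u u' (CE n) (δW n)) (hJ : ∀ n κ u l u', BiLoc (WJ n κ u l u') u u' (CJ n) (δW n))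
    (hΛ : ∀ n κ u l u', BiLoc (WΛ n κ u l u') u u' (CΛ n) (δW n)) (hR : ∀ n κ u l u', BiLoc (WR n κ u l u') u u' (CRt n) (δW n))
    (hQ : ∀ n κ u l u', BiLoc (WQ n κ u l u') u u' (CQ n) (δW n))
    (hEc : ∀ (n : ℕ) (κ : Fin 4) (u : Site 4) (l : Fin 4) (u' t : Site 4),
      WE n κ (u + (n : ℤ) • t) l (u' + (n : ℤ) • t) = shiftK (-((n : ℤ) • t)) (WE n κ u l u'))
    (hJc : ∀ (n : ℕ) (κ : Fin 4) (u : Site 4) (l : Fin 4) (u' t : Site 4),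
      WJ n κ (u + (n : ℤ) • t) l (u' + (n : ℤ) • t) = shiftK (-((n : ℤ) • t)) (WJ n κ u l u'))
    (hΛc : ∀ (n : ℕ) (κ : Fin 4) (u : Site 4) (l : Fin 4) (u' t : Site 4),
      WΛ n κ (u + (n : ℤ) • t) l (u' + (n : ℤ) • t) = shiftK (-((n : ℤ) • t)) (WΛ n κ u l u'))
    (hRc : ∀ (n : ℕ) (κ : Fin 4) (u : Site 4) (l : Fin 4) (u' t : Site 4),
      WR n κ (u + (n : ℤ) • t) l (u' + (n : ℤ) • t) = shiftK (-((n : ℤ) • t)) (WR n κ u l u'))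
    (hQc : ∀ (n : ℕ) (κ : Fin 4) (u : Site 4) (l : Fin 4) (u' t : Site 4),
      WQ n κ (u + (n : ℤ) • t) l (u' + (n : ℤ) • t) = shiftK (-((n : ℤ) • t)) (WQ n κ u l u'))
    (hEs : ∀ n κ u l u', WE n κ u l u' = WE n l u' κ u) (hJs : ∀ n κ u l u', WJ n κ u l u' = WJ n l u' κ u)
    (hΛs : ∀ n κ u l u', WΛ n κ u l u' = WΛ n l u' κ u) (hRs : ∀ n κ u l u', WR n κ u l u' = WR n l u' κ u)
    (hQs : ∀ n κ u l u', WQ n κ u l u' = WQ n l u' κ u)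
    -- first-bond divergence-freeness of the gluon fine Hessian kernel; the ghost Ward rows
    (hdiv : ∀ n : ℕ, 2 ≤ n → ∀ [NeZero n], ∀ (l' : Fin 4) (u' u : Site 4), ∑ κ' : Fin 4,
      (fineHess n a (SbfBal n a (cE n) (cVH n) (cΛ n) (cR n) (cK n) (cQ n))
          (Wbf (cE₂ n) (cJ4 n) (cΛ₂ n) (cR₂ n) (cQ₂ n) (WE n) (WJ n) (WΛ n) (WR n) (WQ n)) κ' l' (u - Pi.single κ' 1) u'
        - fineHess n a (SbfBal n a (cE n) (cVH n) (cΛ n) (cR n) (cK n) (cQ n))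
          (Wbf (cE₂ n) (cJ4 n) (cΛ₂ n) (cR₂ n) (cQ₂ n) (WE n) (WJ n) (WΛ n) (WR n) (WQ n)) κ' l' u u') = 0)
    (hrowgh : ∀ n : ℕ, 2 ≤ n → ∀ [NeZero n], ∀ (κ' l' : Fin 4) (b : Site 4), HasSum (fineHessGhQ n a (x₀ n) (cK n) (cQ n) κ' l' b) 0)
    -- (REST-TOTAL): ONE n-UNIFORM bound on the base-point average of the full sum of THE SUM OF ALL NON-CORNER RE-CUT WORDS; (U)
    (hRestTot : ∀ n : ℕ, 2 ≤ n → ∀ [NeZero n],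
      |∑ b ∈ (univ : Finset (Fin 4 → Fin n)).image resSite, ((n : ℝ) ^ 4)⁻¹ *
        fullSum (fun w : Pt => ∑ τ ∈ (univ : Finset RestIdx).erase cornerIdx,
          restKS n a (gfrz n a b) (fun v => s n * gfrz n a b v) (cE n) (cΛ n) (cR n) (cK n) (cQ n) (cE₂ n) (cJ4 n) (cΛ₂ n) (cR₂ n) (cQ₂ n) (x₀ n)
            (WE n) (WJ n) (WΛ n) (WR n) (WQ n) (ωgl n) (ωgh n) ((n : ℝ) ^ 8) N μ ν b τ w)| ≤ CRtot)
    (hU : ∀ n : ℕ, 2 ≤ n → ∀ u, |Ru u n| ≤ CU u) :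
    D1Drift Lc Js N μ ν := by
  refine d1Drift_of_strongRoad_sbp Js hμν hN hL c (Bset := fun n => (univ : Finset (Fin 4 → Fin n)).image resSite)
    (wt := fun n _ => ((n : ℝ) ^ 4)⁻¹) (Gf := gfrz₀ a) (U₂ := (∑ u, CU u) + (0 + CRtot))
    (D := rowConst a 0) (A := A) (δ := δ)
    (rowConst_nonneg ha le_rfl) hA hδ (fun n _ _ _ => by positivity) (fun n hn => sum_uniform_resSite (by omega)) ?_ ?_ ?_ ?_ hB1 ?_
  · intro n hn b _ v
    haveI : NeZero n := ⟨by omega⟩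
    rw [gfrz₀_eq a n]
    exact abs_gfrz_sub_gFree_le n (le_trans one_le_two hn) ha b v
  · intro n hn b _ v ρ
    haveI : NeZero n := ⟨by omega⟩
    rw [gfrz₀_eq a n]
    exact abs_gfrz_diff_flat_le n (le_trans one_le_two hn) ha b v ρ
  · intro n hn b hb v hv
    haveI : NeZero n := ⟨by omega⟩
    rw [gfrz₀_eq a n]
    exact d0 n hn b hb v hv
  · intro n hn b hb v hv ρ
    haveI : NeZero n := ⟨by omega⟩
    rw [gfrz₀_eq a n]
    exact d1 n hn b hb v hv ρ
  refine hT_of_pointwise (c := c)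
    (F := fun n => ∑ b ∈ (univ : Finset (Fin 4 → Fin n)).image resSite, ((n : ℝ) ^ 4)⁻¹ * fullSum (stK μ ν N (gfrz₀ a n b)))
    (U := (∑ u, CU u) + (0 + CRtot)) (fun n hn hon => ?_) hL hodd
  haveI : NeZero n := ⟨by omega⟩
  rw [gfrz₀_eq a n]
  exact defect_le_at_totalS n a (cE n) (cVH n) (cΛ n) (cR n) (cK n) (cQ n) (cE₂ n) (cJ4 n) (cΛ₂ n) (cR₂ n) (cQ₂ n) (x₀ n) (ωgl n) (ωgh n)
    ((n : ℝ) ^ 8) N (gp := gfrz n a) hn hon ha hμν (hGa n hn) (hK n hn hon) (s n) (hωs n hn) (hlam n hn) (hδW n) (hE n) (hJ n) (hΛ n) (hR n)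
    (hQ n) (hEc n) (hJc n) (hΛc n) (hRc n) (hQc n) (hEs n) (hJs n) (hΛs n) (hRs n) (hQs n) (hdiv n hn) (hrowgh n hn)
    (fun b => decay_gfrz (hGa n hn) b) (fun b w => gfrz_neg w)
    (rest_corner_recutS n a (cE n) (cΛ n) (cR n) (cK n) (cQ n) (cE₂ n) (cJ4 n) (cΛ₂ n) (cR₂ n) (cQ₂ n) (x₀ n) (ωgl n) (ωgh n) N
      (WE n) (WJ n) (WΛ n) (WR n) (WQ n) hμν (hGa n hn) (fun b v => s n * gfrz n a b v)) (hRestTot n hn) (hU n hn)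


/-! ## §2 The total-rest END with d0∕d1 and the (α)-leaf from the printed statements -/

/-- [folklore] **ROAD BF-x, THE DEBT END (total-rest form, summation-by-parts wall — NO LEG ROW DISPLAYED), variant «ENDₛ», WITH d0∕d1 AND `Spr (Ga n a)` FROM [B5, Prop. 1.2] ∧
[B5, (1.126)–(1.127)] BY NAME.**  `d1Drift_BFx_total_sbpS` with the rows d0∕d1 supplied by `FrozenLegTails.far_rows_d0_d1_of_prop12` and `hGa` by `GluonLegTails.hGa_of_prop12`
from the two printed statements `h12`∕`h126` (hypotheses, NOT proved here) — NO LEG ROW remains displayed;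
B1, (K) with `hωs`, the sockets, `hdiv`, `hrowgh`, `hRestTot` (two-profile words) and (U) remain displayed verbatim. -/
theorem d1Drift_BFx_total_sbp_of_prop12S (Js : ℕ → JetData 3 Lc) (hμν : μ ≠ ν) (hN : N ≠ 0) (hL : 2 ≤ Lc) (hodd : Odd Lc) (ha : 0 < a)
    (c : ℕ → ℝ)
    -- the two PRINTED statements, by name, for the family scale × even cubic volumes
    (h12 : B5.Prop12Printed (fam nOf hn1 MOf a ha)) (h126 : B5.Kernel126_127Printed (kfam nOf MOf))
    -- bridge B1
    (hB1 : ∀ m : ℕ, 1 ≤ m → |(∑ j ∈ range m, B12Beta.secondMoment (TbalOf Lc Js j) μ ν) - c (Lc ^ m)| ≤ U₁)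
    -- slot (K) with the loop-weight ratio and the PINNED normalisation
    (hK : ∀ n : ℕ, 2 ≤ n → Odd n → ∀ [NeZero n], c n =
      ωgl n * B12Beta.secondMoment (TOfRed n a (SbfBal n a (cE n) (cVH n) (cΛ n) (cR n) (cK n) (cQ n))
        (tableRed n (Wbf (cE₂ n) (cJ4 n) (cΛ₂ n) (cR₂ n) (cQ₂ n) (WE n) (WJ n) (WΛ n) (WR n) (WQ n)))) μ ν
      + ωgh n * B12Beta.secondMoment (PghQ n a (x₀ n) (cK n) (cQ n)) μ ν + ∑ u, Ru u n)
    (s : ℕ → ℝ) (hωs : ∀ n : ℕ, 2 ≤ n → ωgh n * (s n * cK n) ^ 2 = -2 * (ωgl n * cE n ^ 2))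
    (hlam : ∀ n : ℕ, 2 ≤ n → ωgl n * cE n ^ 2 = 2 * N ^ 2 * (n : ℝ) ^ 8)
    -- slot-table sockets
    (hδW : ∀ n, 0 < δW n)
    (hE : ∀ n κ u l u', BiLoc (WE n κ u l u') u u' (CE n) (δW n)) (hJ : ∀ n κ u l u', BiLoc (WJ n κ u l u') u u' (CJ n) (δW n))
    (hΛ : ∀ n κ u l u', BiLoc (WΛ n κ u l u') u u' (CΛ n) (δW n)) (hR : ∀ n κ u l u', BiLoc (WR n κ u l u') u u' (CRt n) (δW n))
    (hQ : ∀ n κ u l u', BiLoc (WQ n κ u l u') u u' (CQ n) (δW n))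
    (hEc : ∀ (n : ℕ) (κ : Fin 4) (u : Site 4) (l : Fin 4) (u' t : Site 4),
      WE n κ (u + (n : ℤ) • t) l (u' + (n : ℤ) • t) = shiftK (-((n : ℤ) • t)) (WE n κ u l u'))
    (hJc : ∀ (n : ℕ) (κ : Fin 4) (u : Site 4) (l : Fin 4) (u' t : Site 4),
      WJ n κ (u + (n : ℤ) • t) l (u' + (n : ℤ) • t) = shiftK (-((n : ℤ) • t)) (WJ n κ u l u'))
    (hΛc : ∀ (n : ℕ) (κ : Fin 4) (u : Site 4) (l : Fin 4) (u' t : Site 4),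
      WΛ n κ (u + (n : ℤ) • t) l (u' + (n : ℤ) • t) = shiftK (-((n : ℤ) • t)) (WΛ n κ u l u'))
    (hRc : ∀ (n : ℕ) (κ : Fin 4) (u : Site 4) (l : Fin 4) (u' t : Site 4),
      WR n κ (u + (n : ℤ) • t) l (u' + (n : ℤ) • t) = shiftK (-((n : ℤ) • t)) (WR n κ u l u'))
    (hQc : ∀ (n : ℕ) (κ : Fin 4) (u : Site 4) (l : Fin 4) (u' t : Site 4),
      WQ n κ (u + (n : ℤ) • t) l (u' + (n : ℤ) • t) = shiftK (-((n : ℤ) • t)) (WQ n κ u l u'))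
    (hEs : ∀ n κ u l u', WE n κ u l u' = WE n l u' κ u) (hJs : ∀ n κ u l u', WJ n κ u l u' = WJ n l u' κ u)
    (hΛs : ∀ n κ u l u', WΛ n κ u l u' = WΛ n l u' κ u) (hRs : ∀ n κ u l u', WR n κ u l u' = WR n l u' κ u)
    (hQs : ∀ n κ u l u', WQ n κ u l u' = WQ n l u' κ u)
    -- first-bond divergence-freeness of the gluon fine Hessian kernel; the ghost Ward rows
    (hdiv : ∀ n : ℕ, 2 ≤ n → ∀ [NeZero n], ∀ (l' : Fin 4) (u' u : Site 4), ∑ κ' : Fin 4,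
      (fineHess n a (SbfBal n a (cE n) (cVH n) (cΛ n) (cR n) (cK n) (cQ n))
          (Wbf (cE₂ n) (cJ4 n) (cΛ₂ n) (cR₂ n) (cQ₂ n) (WE n) (WJ n) (WΛ n) (WR n) (WQ n)) κ' l' (u - Pi.single κ' 1) u'
        - fineHess n a (SbfBal n a (cE n) (cVH n) (cΛ n) (cR n) (cK n) (cQ n))
          (Wbf (cE₂ n) (cJ4 n) (cΛ₂ n) (cR₂ n) (cQ₂ n) (WE n) (WJ n) (WΛ n) (WR n) (WQ n)) κ' l' u u') = 0)
    (hrowgh : ∀ n : ℕ, 2 ≤ n → ∀ [NeZero n], ∀ (κ' l' : Fin 4) (b : Site 4), HasSum (fineHessGhQ n a (x₀ n) (cK n) (cQ n) κ' l' b) 0)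
    -- (REST-TOTAL); (U)
    (hRestTot : ∀ n : ℕ, 2 ≤ n → ∀ [NeZero n],
      |∑ b ∈ (univ : Finset (Fin 4 → Fin n)).image resSite, ((n : ℝ) ^ 4)⁻¹ *
        fullSum (fun w : Pt => ∑ τ ∈ (univ : Finset RestIdx).erase cornerIdx,
          restKS n a (gfrz n a b) (fun v => s n * gfrz n a b v) (cE n) (cΛ n) (cR n) (cK n) (cQ n) (cE₂ n) (cJ4 n) (cΛ₂ n) (cR₂ n) (cQ₂ n) (x₀ n)
            (WE n) (WJ n) (WΛ n) (WR n) (WQ n) (ωgl n) (ωgh n) ((n : ℝ) ^ 8) N μ ν b τ w)| ≤ CRtot)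
    (hU : ∀ n : ℕ, 2 ≤ n → ∀ u, |Ru u n| ≤ CU u) :
    D1Drift Lc Js N μ ν := by
  obtain ⟨δ₁, A₀, A₁, hδ₁, hA₀, hA₁, hd0, hd1⟩ := far_rows_d0_d1_of_prop12 ha h12 h126
  exact d1Drift_BFx_total_sbpS (A := tailConst A₀ A₁ 0) (δ := δ₁) Js hμν hN hL hodd ha c (tailConst_nonneg hA₀ hA₁ le_rfl) hδ₁
    (fun n hn _ b hb v hv => hd0 n hn b hb v hv) (fun n hn _ b hb v hv ρ => hd1 n hn b hb v hv ρ) hB1 (hGa_of_prop12 ha h12 h126) hK s hωs hlam hδW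
    hE hJ hΛ hR hQ hEc hJc hΛc hRc hQc hEs hJs hΛs hRs hQs hdiv hrowgh hRestTot hU

/-! ## §3 The same END fed by a per-word (REST′) family -/

/-- [folklore] **THE «ENDₛ» DEBT END FED BY PER-WORD REST BOUNDS**: `d1Drift_BFx_total_sbp_of_prop12S` with `hRestTot` supplied by the owner's
`RestTotalOfWordsS.hRestTot_of_hRestS` from a per-word family `hRest` on the two-profile words (`∀ τ ≠ cornerIdx`, n-uniform constants `CR τ`), `CRtot := Σ_{τ ≠ cornerIdx} CR τ`;
the glue's (α)-leaf input is `GluonLegTails.hGa_of_prop12`.  Displayed: B1, (K), sockets, `hdiv`, `hrowgh`, `hRest` per word, (U) — no leg row —,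
`h12`∕`h126`. -/
theorem d1Drift_BFx_total_sbp_of_prop12_of_perWordS (Js : ℕ → JetData 3 Lc) (hμν : μ ≠ ν) (hN : N ≠ 0) (hL : 2 ≤ Lc) (hodd : Odd Lc)
    (ha : 0 < a) (c : ℕ → ℝ) {CR : RestIdx → ℝ}
    (h12 : B5.Prop12Printed (fam nOf hn1 MOf a ha)) (h126 : B5.Kernel126_127Printed (kfam nOf MOf))
    (hB1 : ∀ m : ℕ, 1 ≤ m → |(∑ j ∈ range m, B12Beta.secondMoment (TbalOf Lc Js j) μ ν) - c (Lc ^ m)| ≤ U₁)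
    (hK : ∀ n : ℕ, 2 ≤ n → Odd n → ∀ [NeZero n], c n =
      ωgl n * B12Beta.secondMoment (TOfRed n a (SbfBal n a (cE n) (cVH n) (cΛ n) (cR n) (cK n) (cQ n))
        (tableRed n (Wbf (cE₂ n) (cJ4 n) (cΛ₂ n) (cR₂ n) (cQ₂ n) (WE n) (WJ n) (WΛ n) (WR n) (WQ n)))) μ ν
      + ωgh n * B12Beta.secondMoment (PghQ n a (x₀ n) (cK n) (cQ n)) μ ν + ∑ u, Ru u n)
    (s : ℕ → ℝ) (hωs : ∀ n : ℕ, 2 ≤ n → ωgh n * (s n * cK n) ^ 2 = -2 * (ωgl n * cE n ^ 2))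
    (hlam : ∀ n : ℕ, 2 ≤ n → ωgl n * cE n ^ 2 = 2 * N ^ 2 * (n : ℝ) ^ 8)
    (hδW : ∀ n, 0 < δW n)
    (hE : ∀ n κ u l u', BiLoc (WE n κ u l u') u u' (CE n) (δW n)) (hJ : ∀ n κ u l u', BiLoc (WJ n κ u l u') u u' (CJ n) (δW n))
    (hΛ : ∀ n κ u l u', BiLoc (WΛ n κ u l u') u u' (CΛ n) (δW n)) (hR : ∀ n κ u l u', BiLoc (WR n κ u l u') u u' (CRt n) (δW n))
    (hQ : ∀ n κ u l u', BiLoc (WQ n κ u l u') u u' (CQ n) (δW n))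
    (hEc : ∀ (n : ℕ) (κ : Fin 4) (u : Site 4) (l : Fin 4) (u' t : Site 4),
      WE n κ (u + (n : ℤ) • t) l (u' + (n : ℤ) • t) = shiftK (-((n : ℤ) • t)) (WE n κ u l u'))
    (hJc : ∀ (n : ℕ) (κ : Fin 4) (u : Site 4) (l : Fin 4) (u' t : Site 4),
      WJ n κ (u + (n : ℤ) • t) l (u' + (n : ℤ) • t) = shiftK (-((n : ℤ) • t)) (WJ n κ u l u'))
    (hΛc : ∀ (n : ℕ) (κ : Fin 4) (u : Site 4) (l : Fin 4) (u' t : Site 4),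
      WΛ n κ (u + (n : ℤ) • t) l (u' + (n : ℤ) • t) = shiftK (-((n : ℤ) • t)) (WΛ n κ u l u'))
    (hRc : ∀ (n : ℕ) (κ : Fin 4) (u : Site 4) (l : Fin 4) (u' t : Site 4),
      WR n κ (u + (n : ℤ) • t) l (u' + (n : ℤ) • t) = shiftK (-((n : ℤ) • t)) (WR n κ u l u'))
    (hQc : ∀ (n : ℕ) (κ : Fin 4) (u : Site 4) (l : Fin 4) (u' t : Site 4),
      WQ n κ (u + (n : ℤ) • t) l (u' + (n : ℤ) • t) = shiftK (-((n : ℤ) • t)) (WQ n κ u l u'))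
    (hEs : ∀ n κ u l u', WE n κ u l u' = WE n l u' κ u) (hJs : ∀ n κ u l u', WJ n κ u l u' = WJ n l u' κ u)
    (hΛs : ∀ n κ u l u', WΛ n κ u l u' = WΛ n l u' κ u) (hRs : ∀ n κ u l u', WR n κ u l u' = WR n l u' κ u)
    (hQs : ∀ n κ u l u', WQ n κ u l u' = WQ n l u' κ u)
    (hdiv : ∀ n : ℕ, 2 ≤ n → ∀ [NeZero n], ∀ (l' : Fin 4) (u' u : Site 4), ∑ κ' : Fin 4,
      (fineHess n a (SbfBal n a (cE n) (cVH n) (cΛ n) (cR n) (cK n) (cQ n))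
          (Wbf (cE₂ n) (cJ4 n) (cΛ₂ n) (cR₂ n) (cQ₂ n) (WE n) (WJ n) (WΛ n) (WR n) (WQ n)) κ' l' (u - Pi.single κ' 1) u'
        - fineHess n a (SbfBal n a (cE n) (cVH n) (cΛ n) (cR n) (cK n) (cQ n))
          (Wbf (cE₂ n) (cJ4 n) (cΛ₂ n) (cR₂ n) (cQ₂ n) (WE n) (WJ n) (WΛ n) (WR n) (WQ n)) κ' l' u u') = 0)
    (hrowgh : ∀ n : ℕ, 2 ≤ n → ∀ [NeZero n], ∀ (κ' l' : Fin 4) (b : Site 4), HasSum (fineHessGhQ n a (x₀ n) (cK n) (cQ n) κ' l' b) 0)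
    -- (REST′) PER WORD, n-UNIFORM, off the corner; (U)
    (hRest : ∀ n : ℕ, 2 ≤ n → ∀ [NeZero n], ∀ τ : RestIdx, τ ≠ cornerIdx →
      |∑ b ∈ (univ : Finset (Fin 4 → Fin n)).image resSite, ((n : ℝ) ^ 4)⁻¹ *
        fullSum (fun w : Pt => restKS n a (gfrz n a b) (fun v => s n * gfrz n a b v) (cE n) (cΛ n) (cR n) (cK n) (cQ n) (cE₂ n) (cJ4 n) (cΛ₂ n) (cR₂ n) (cQ₂ n) (x₀ n)
          (WE n) (WJ n) (WΛ n) (WR n) (WQ n) (ωgl n) (ωgh n) ((n : ℝ) ^ 8) N μ ν b τ w)| ≤ CR τ)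
    (hU : ∀ n : ℕ, 2 ≤ n → ∀ u, |Ru u n| ≤ CU u) :
    D1Drift Lc Js N μ ν :=
  d1Drift_BFx_total_sbp_of_prop12S Js hμν hN hL hodd ha c h12 h126 hB1 hK s hωs hlam hδW hE hJ hΛ hR hQ hEc hJc hΛc hRc hQc
    hEs hJs hΛs hRs hQs hdiv hrowgh
    (hRestTot_of_hRestS ha hμν (hGa_of_prop12 ha h12 h126) hδW hE hJ hΛ hR hQ s hRest) hU

end Summit.QuantumFields.BalabanUV.Beta.D1BFx.RoadEndBFxTotalSbpS

end
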